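import Literature.IUT.HodgeTheaters.GoodLocalFrobenioidKindFunctors
import Mathlib.CategoryTheory.Conj
import HarnessLib

/-!
# [IUTchI] Example 3.3 (iii) (e) ON ISOMORPHISMS OF CATEGORIES: `Aut(ℱ⊢_v)` of the SPLIT Frobenioid
# `ℱ⊢_v = (𝒞⊢_v, τ⊢_v)` and the induced homomorphism `Aut(ℱ̲_v) → Aut(ℱ⊢_v)` (our §0 reading), AT THE GENUINE PLACE

S. Mochizuki, *Inter-universal Teichmüller theory I*, kurims manuscript (May 2020), §0 p. 33 ("isomorphism of
categories" = isomorphism class of equivalences); Example 3.2 (v) p. 73 l. 20–24 ("we shall refer to a pair such as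
`ℱ⊢_v` or `ℱ^Θ_v` consisting of a Frobenioid equipped with a collection of characteristic splittings as a split
Frobenioid"); Example 3.3 (i) p. 78 l. 46–50 ("the element `p_v` … determines a characteristic splitting `τ⊢_v`");
Example 3.3 (iii) p. 79 l. 52–63, verbatim with our elision «…»: *"Finally, by applying the algorithmically constructed
field structure on the image of the Kummer map of [AbsTopIII], Proposition 3.2, (iii) [cf. Remark 3.1.2; Remark 3.3.2
below], it follows that one may construct the element “`p_v`” of `O^▷_{K_v}` category-theoretically from `ℱ̲_v`, hence
that the characteristic splitting `τ⊢_v` may be reconstructed category-theoretically from `ℱ̲_v`. «…» In particular, (e)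
one may reconstruct the split Frobenioids `ℱ⊢_v`, `ℱ^Θ_v` category-theoretically from `ℱ̲_v`."*; Corollary 5.3 (iv) p. 144
l. 22–23 (*"the natural homomorphism `Aut(ℱ̲_v) → Aut(𝒟_v)`"*, print's phrase at `v ∈ 𝕍^bad` — the MODEL for our §0
reading of (e) as an induced homomorphism `Aut(ℱ̲_v) → Aut(ℱ⊢_v)`, which is OURS, not a phrase of Example 3.3);
Corollary 3.7 (iii) / Definition 3.6 (the passage `ℱ̲_v ↦ ℱ⊢_v` of a Θ-Hodge theater) ([IUTchI] Ex 3.3 (iii)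
(e) p.79) [claim: Mochizuki2012, status: disputed] (D-0012 claim key, status DISPUTED — nothing of the series is asserted;
no side is taken on [IUTchIII] Cor. 3.12).  The splitting `τ⊢_v = τ_p` is [FrdII] Thm. 1.2 (v) p. 9
[cite: MochizukiFrdII2008, Thm 1.2 (v) p.9]; its subfunctoriality is [FrdI] Def. 2.3 p. 47 [cite: MochizukiFrdI2008, Def. 2.3 p.47].

WHY.  abc-iut-L5-t2 typed clause (e) as `GoodLocalFrobenioid.SplitFromF`: every self-equivalence `e` of `𝒞_v` has SOME
lift `e'` to `𝒞⊢_v` preserving `τ⊢_v` (`S3Local.CharSplitting.IsPreservedBy`).  To read (e) as the slot `dashOf v`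
(`ℱ̲_v ↦ ℱ⊢_v`) of abc-iut-L5-t2's `HodgeTheaterModel` in design F1 of the «genuine ℱ-prime-strip kit» hub (kinds :=
`SingleObj (CatAut −)`, abc-iut-L5-t4), one needs `Aut(ℱ⊢_v)` as a SUBGROUP of `Aut(𝒞⊢_v)` — the classes of
self-equivalences preserving `τ⊢_v` — which is well defined only if *preserving `τ`* passes along isomorphisms of
functors; t2's `CharSplitting` (a bare family `A ↦ τ(A) ⊆ End(A)`) carries no axiom making that so.  This file (seat
abc-iut-w4-d047 gen 9; hub row «E33III-E-ON-THE-CLASS», sequel of R44) supplies the missing hinge and discharges it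
at the genuine objects:

* §1 (generic over t2's `S3Local.CharSplitting`): the predicate `CharSplitting.IsIsoInvariant τ` (conjugation by an
  isomorphism carries `τ(A)` into `τ(B)`; a predicate with parameters, never asserted), `map_conj_eq`, the calculus of
  `IsPreservedBy` (`id`, `comp`, `of_iso`, `symm` — the inverse of a `τ`-preserving equivalence preserves `τ`), and
  **`CharSplitting.autSplit τ hτ : Subgroup (CatAut C)` = `Aut(ℱ)` of the split Frobenioid `(C, τ)`** with
  `mk_mem_autSplit_iff`;
* §2 (any `G : GoodLocalFrobenioid`): **`dashAscendHom G h hu hτ : CatAut 𝒞_v →* Aut(ℱ⊢_v)`** from clause (e)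
  `h : G.SplitFromF`, the uniqueness binder `hu` of FILE 2 (p496061) and `hτ : IsIsoInvariant τ⊢_v` — the natural
  homomorphism `Aut(ℱ̲_v) → Aut(ℱ⊢_v)` — and its one-object kind functor `dashKindFunctor` (= t2's `dashOf v`), with
  `subtype ∘ dashAscendHom = cdashAscendHom` (`dashAscendHom_coe`);
* §3 AT abc-iut-L1-t4's assembled object `ofKit`: **`isIsoInvariant_tauDash_ofKit`, BINDER-FREE** — `τ⊢_v = τ_p` is a
  subfunctor of `O^▷(−)` on linear arrows (abc-iut-L1's `PadicFrd.Datum.mem_pSplittingSubmonoid_of_comp_eq`),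
  isomorphisms are linear (`PreFrobenioid.isLinear_of_isIso`) and conjugation preserves `O^▷` (`endConj_mem`); hence at
  `ofGalois`, at the printed object `goodLocalFrobenioidOfEmb` and AT THE FINITE PLACE `v̲ = w ∣ p`
  (`isIsoInvariant_tauDash_goodLocalFrobenioidAt`, binder-free beyond `hX`), and
  **`InitialThetaData.dashKindFunctorAt (hX) (he)`** — the passage `ℱ̲_v̲ ↦ ℱ⊢_v̲` on one-object kinds for the genuine
  datum, displayed input = clause (e) `he : SplitFromF` itself (dischargers of record: this seat's
  `splitFromF_goodLocalFrobenioidAt_of_conj_autCongr` ★ p487663 {hX, hΔC, hΔ, DATA e, hconj = GAP G-L5t16g8-1} or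
  abc-iut-L5-t16's by-name form ★ p490831) — so the GAP hypothesis enters the kind functors through (e) alone.

0 instance, 0 notation, 0 new Prop FACT (one predicate with parameters); typed ≠ inhabited ≠ proved.  (Doc-only revision:
referee rule of M26-F2 applied — quotation marks enclose verbatim print only, the `Aut`-homomorphism reading is marked as
ours; statements and proofs are byte-identical to the first landing.)
-/

noncomputable section

namespace Literature.IUT.HodgeTheaters

open CategoryTheory Literature.AnabelianGeometry.SemiGraphs Literature.AlgebraicGeometry.Frobenioids
open Literature.AlgebraicGeometry.Frobenioids.PadicFrd Literature.AnabelianGeometry.AbsoluteAnabelian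
open Literature.NumberTheory.NumberFields IsDedekindDomain NumberField

universe u

/-! ### §1. Iso-invariant characteristic splittings; `Aut(ℱ)` of a split Frobenioid as a subgroup of `Aut(𝒞)` -/

namespace S3Local.CharSplitting

section IsoInvariant

variable {C : Type u} [Category.{u} C] {C' : Type u} [Category.{u} C'] {C'' : Type u} [Category.{u} C'']

/-- A characteristic splitting `τ` (abc-iut-L5-t2's bare family `A ↦ τ(A) ⊆ End(A)`) is **iso-invariant** if
conjugation by every isomorphism `i : A ⥲ B` of the category carries `τ(A)` into `τ(B)` ([FrdI] Def. 2.3: `τ` is a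
subfunctor of `O^▷(−)` on linear arrows — the axiom t2's interface omits).  A predicate with parameters, never
asserted; DISCHARGED below for the genuine `τ⊢_v`. ([IUTchI] Ex 3.2 (v) p.73) [claim: Mochizuki2012, status: disputed] -/
def IsIsoInvariant (τ : CharSplitting C) : Prop :=
  ∀ ⦃A B : C⦄ (i : A ≅ B) ⦃f : End A⦄, f ∈ τ.sect A → i.conj f ∈ τ.sect B

variable {τ : CharSplitting C} {τ' : CharSplitting C'} {τ'' : CharSplitting C''}

/-- Under iso-invariance, conjugation by `i : A ⥲ B` carries `τ(A)` ONTO `τ(B)`.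
([IUTchI] Ex 3.2 (v) p.73) [claim: Mochizuki2012, status: disputed] -/
theorem map_conj_eq (hτ : τ.IsIsoInvariant) {A B : C} (i : A ≅ B) :
    (τ.sect A).map i.conj.toMonoidHom = τ.sect B := by
  ext g
  constructor
  · rintro ⟨f, hf, rfl⟩
    exact hτ i hf
  · intro hg
    exact ⟨i.symm.conj g, hτ i.symm hg, i.self_symm_conj g⟩

/-- If `Φ` carries `τ(A)` onto `τ'(Φ A)`, images of elements of `τ(A)` lie in `τ'(Φ A)`.
([IUTchI] Ex 3.2 (v) p.73) [claim: Mochizuki2012, status: disputed] -/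
theorem IsPreservedBy.map_mem {Φ : C ⥤ C'} (h : τ.IsPreservedBy τ' Φ) {A : C} {f : End A} (hf : f ∈ τ.sect A) :
    (Φ.map f : End (Φ.obj A)) ∈ τ'.sect (Φ.obj A) := by
  rw [← h A]
  exact ⟨f, hf, rfl⟩

/-- If `Φ` carries `τ(A)` onto `τ'(Φ A)`, every element of `τ'(Φ A)` is the image of one of `τ(A)`.
([IUTchI] Ex 3.2 (v) p.73) [claim: Mochizuki2012, status: disputed] -/
theorem IsPreservedBy.exists_eq {Φ : C ⥤ C'} (h : τ.IsPreservedBy τ' Φ) {A : C} {g : End (Φ.obj A)}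
    (hg : g ∈ τ'.sect (Φ.obj A)) : ∃ f ∈ τ.sect A, (Φ.map f : End (Φ.obj A)) = g := by
  rw [← h A] at hg
  obtain ⟨f, hf, rfl⟩ := hg
  exact ⟨f, hf, rfl⟩

/-- The identity functor preserves every splitting. ([IUTchI] Ex 3.2 (v) p.73) [claim: Mochizuki2012, status: disputed] -/
theorem IsPreservedBy.id (τ : CharSplitting C) : τ.IsPreservedBy τ (𝟭 C) := by
  intro A
  ext g
  constructor
  · rintro ⟨f, hf, rfl⟩
    exact hf
  · intro hg
    exact ⟨g, hg, rfl⟩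

/-- `τ`-preservation composes. ([IUTchI] Ex 3.2 (v) p.73) [claim: Mochizuki2012, status: disputed] -/
theorem IsPreservedBy.comp {Φ : C ⥤ C'} {Φ' : C' ⥤ C''} (h : τ.IsPreservedBy τ' Φ) (h' : τ'.IsPreservedBy τ'' Φ') :
    τ.IsPreservedBy τ'' (Φ ⋙ Φ') := by
  intro A
  ext g
  constructor
  · rintro ⟨f, hf, rfl⟩
    exact h'.map_mem (h.map_mem hf)
  · intro hg
    obtain ⟨f', hf', rfl⟩ := h'.exists_eq (A := Φ.obj A) hg
    obtain ⟨f, hf, rfl⟩ := h.exists_eq hf'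
    exact ⟨f, hf, rfl⟩

/-- Along an isomorphism of functors `α : Φ ≅ Φ'`, `Φ'` acts on endomorphisms as `Φ` followed by conjugation by the
component `Φ A ⥲ Φ' A`. [folklore] ([IUTchI] Ex 3.2 (v) p.73) [claim: Mochizuki2012, status: disputed] -/
theorem map_eq_conj_map_of_iso {Φ Φ' : C ⥤ C'} (α : Φ ≅ Φ') {A : C} (f : End A) :
    (Φ'.map f : End (Φ'.obj A)) = (α.app A).conj (Φ.map f) := by
  rw [Iso.conj_apply, Iso.app_inv, Iso.app_hom, α.hom.naturality f, ← Category.assoc, Iso.inv_hom_id_app,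
    Category.id_comp]

/-- **`τ`-preservation passes along isomorphisms of functors when the target splitting is iso-invariant**: if
`Φ ≅ Φ'` and `Φ` carries `τ(A)` onto `τ'(Φ A)` then `Φ'` carries `τ(A)` onto `τ'(Φ' A)` (conjugate by the component
`Φ A ⥲ Φ' A`).  This is the hinge that makes *preserving `τ`* a property of the §0 isomorphism CLASS.
([IUTchI] Ex 3.2 (v) p.73) [claim: Mochizuki2012, status: disputed] -/
theorem IsPreservedBy.of_iso (hτ' : τ'.IsIsoInvariant) {Φ Φ' : C ⥤ C'} (h : τ.IsPreservedBy τ' Φ) (α : Φ ≅ Φ') :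
    τ.IsPreservedBy τ' Φ' := by
  intro A
  ext g
  constructor
  · rintro ⟨f, hf, rfl⟩
    change (Φ'.map f : End (Φ'.obj A)) ∈ τ'.sect (Φ'.obj A)
    rw [map_eq_conj_map_of_iso α f]
    exact hτ' (α.app A) (h.map_mem hf)
  · intro hg
    obtain ⟨f, hf, hfg⟩ := h.exists_eq (hτ' (α.app A).symm hg)
    refine ⟨f, hf, ?_⟩
    change (Φ'.map f : End (Φ'.obj A)) = g
    rw [map_eq_conj_map_of_iso α f, hfg, Iso.self_symm_conj]

/-- **The inverse of a `τ`-preserving self-equivalence preserves `τ`** (for iso-invariant `τ`): `e.inverse ⋙ e.functor ≅ 𝟭`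
preserves `τ` (`of_iso`), and both `e.functor` and `e.inverse ⋙ e.functor` are faithful (and `e.inverse` full), so
membership is reflected along them. ([IUTchI] Ex 3.2 (v) p.73) [claim: Mochizuki2012, status: disputed] -/
theorem IsPreservedBy.symm (hτ : τ.IsIsoInvariant) {e : C ≌ C} (h : τ.IsPreservedBy τ e.functor) :
    τ.IsPreservedBy τ e.inverse := by
  have hc : τ.IsPreservedBy τ (e.inverse ⋙ e.functor) :=
    IsPreservedBy.of_iso hτ (IsPreservedBy.id τ) e.counitIso.symm
  intro B
  ext g
  constructor
  · rintro ⟨f, hf, rfl⟩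
    obtain ⟨g', hg', hgg'⟩ := h.exists_eq (hc.map_mem hf)
    have hg'f : g' = e.inverse.map f := e.functor.map_injective hgg'
    change (e.inverse.map f : End (e.inverse.obj B)) ∈ τ.sect (e.inverse.obj B)
    rw [← hg'f]
    exact hg'
  · intro hg
    -- the preimage of `g` under the fully faithful `e.inverse`
    obtain ⟨f, hgf⟩ : ∃ f : B ⟶ B, e.inverse.map f = g := ⟨e.inverse.preimage g, e.inverse.map_preimage _⟩
    subst hgf
    have h1 : ((e.inverse ⋙ e.functor).map f : End ((e.inverse ⋙ e.functor).obj B)) ∈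
        τ.sect ((e.inverse ⋙ e.functor).obj B) := h.map_mem hg
    obtain ⟨f', hf', hff'⟩ := hc.exists_eq h1
    have hf'f : f' = f := (e.inverse ⋙ e.functor).map_injective hff'
    subst hf'f
    exact ⟨f', hf', rfl⟩

/-- **`Aut(ℱ)` of the split Frobenioid `ℱ = (C, τ)` as a subgroup of `Aut(C)`** (§0 currency): the isomorphism classes
of self-equivalences of `C` preserving `τ` — well defined and a subgroup because `τ` is iso-invariant
(`IsPreservedBy.of_iso`, `.comp`, `.id`, `.symm`). ([IUTchI] Ex 3.2 (v) p.73) [claim: Mochizuki2012, status: disputed] -/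
def autSplit (τ : CharSplitting C) (hτ : τ.IsIsoInvariant) : Subgroup (CatAut C) where
  carrier := {c | ∃ e : C ≌ C, CatIsomorphism.mk e = c ∧ τ.IsPreservedBy τ e.functor}
  one_mem' := ⟨CategoryTheory.Equivalence.refl, (CatAut.one_def C).symm ▸ rfl, IsPreservedBy.id τ⟩
  mul_mem' := by
    rintro a b ⟨e, rfl, he⟩ ⟨e', rfl, he'⟩
    exact ⟨e'.trans e, by rw [CatAut.mul_def, CatIsomorphism.mk_comp_mk], IsPreservedBy.comp he' he⟩
  inv_mem' := by
    rintro a ⟨e, rfl, he⟩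
    exact ⟨e.symm, by rw [CatAut.inv_def, CatIsomorphism.symm_mk], IsPreservedBy.symm hτ he⟩

/-- Membership in `Aut(ℱ)` is `τ`-preservation of ANY representative. ([IUTchI] Ex 3.2 (v) p.73) [claim: Mochizuki2012, status: disputed] -/
theorem mk_mem_autSplit_iff (hτ : τ.IsIsoInvariant) (e : C ≌ C) :
    CatIsomorphism.mk e ∈ τ.autSplit hτ ↔ τ.IsPreservedBy τ e.functor := by
  constructor
  · rintro ⟨e', he', h'⟩
    obtain ⟨i⟩ := (CatIsomorphism.mk_eq_mk_iff e' e).1 he'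
    exact IsPreservedBy.of_iso hτ h' i
  · intro h
    exact ⟨e, rfl, h⟩

end IsoInvariant

end S3Local.CharSplitting

/-! ### §2. The induced homomorphism `Aut(ℱ̲_v) → Aut(ℱ⊢_v)` (our §0 reading) for any inhabitant of the Ex. 3.3 interface -/

namespace GoodLocalFrobenioid

section Generic

variable {p : ℕ} {Kv : Type} [Field Kv] [ValuativeRel Kv] (G : GoodLocalFrobenioid.{u} p Kv)

/-- Clause (e) contains clause (d): the lift it provides is in particular a lift.
([IUTchI] Ex 3.3 (iii) (e) p.79) [claim: Mochizuki2012, status: disputed] -/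
theorem cdashFromF_of_splitFromF (h : G.SplitFromF) : G.CdashFromF := fun e => by
  obtain ⟨e', -, hi, -⟩ := h e
  exact ⟨e', hi⟩

/-- The lifted class lies in `Aut(ℱ⊢_v)`: by (e) SOME lift preserves `τ⊢_v`, by `LiftUnique` every lift is isomorphic
to it, and by iso-invariance preservation passes along. ([IUTchI] Ex 3.3 (iii) (e) p.79) [claim: Mochizuki2012, status: disputed] -/
theorem cdashAscendHom_mem_autSplit (h : G.SplitFromF) (hu : CatIsomorphism.LiftUnique G.CdashToC G.CdashToC)
    (hτ : G.tauDash.IsIsoInvariant) (a : CatAut G.Cv) :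
    G.cdashAscendHom (G.cdashFromF_of_splitFromF h) hu a ∈ G.tauDash.autSplit hτ := by
  obtain ⟨e, rfl⟩ := CatIsomorphism.mk_surjective a
  obtain ⟨e', -, ⟨i⟩, he', -⟩ := h e
  rw [G.cdashAscendHom_mk (G.cdashFromF_of_splitFromF h) hu i]
  exact ⟨e', rfl, he'⟩

/-- **[IUTchI] Ex. 3.3 (iii) (e) ON ISOMORPHISMS OF CATEGORIES — our §0 reading: the induced homomorphism
`Aut(ℱ̲_v) → Aut(ℱ⊢_v)`** (print says only that one "may reconstruct the split Frobenioids `ℱ⊢_v`, `ℱ^Θ_v`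
category-theoretically from `ℱ̲_v`") into the automorphism group of the SPLIT Frobenioid `ℱ⊢_v = (𝒞⊢_v, τ⊢_v)`: from clause (e), the uniqueness binder of
the lift along `𝒞⊢_v ⊆ 𝒞_v` and the iso-invariance of `τ⊢_v` (both discharged at the genuine objects below).
([IUTchI] Ex 3.3 (iii) (e) p.79) [claim: Mochizuki2012, status: disputed] -/
def dashAscendHom (h : G.SplitFromF) (hu : CatIsomorphism.LiftUnique G.CdashToC G.CdashToC)
    (hτ : G.tauDash.IsIsoInvariant) : CatAut G.Cv →* G.tauDash.autSplit hτ :=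
  (G.cdashAscendHom (G.cdashFromF_of_splitFromF h) hu).codRestrict _ (G.cdashAscendHom_mem_autSplit h hu hτ)

/-- Forgetting the splitting, `dashAscendHom` is FILE 2's `cdashAscendHom` (`Aut(ℱ⊢_v) ⊆ Aut(𝒞⊢_v)`).
([IUTchI] Ex 3.3 (iii) (e) p.79) [claim: Mochizuki2012, status: disputed] -/
theorem dashAscendHom_coe (h : G.SplitFromF) (hu : CatIsomorphism.LiftUnique G.CdashToC G.CdashToC)
    (hτ : G.tauDash.IsIsoInvariant) (a : CatAut G.Cv) :
    ((G.dashAscendHom h hu hτ a : G.tauDash.autSplit hτ) : CatAut G.Cdash) =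
      G.cdashAscendHom (G.cdashFromF_of_splitFromF h) hu a := rfl

/-- **The passage `ℱ̲_v ↦ ℱ⊢_v` as a functor of one-object kinds** (t2's slot `dashOf v` in design F1: the kind of the
split Frobenioid is `SingleObj Aut(ℱ⊢_v)`). ([IUTchI] Ex 3.3 (iii) (e) p.79) [claim: Mochizuki2012, status: disputed] -/
def dashKindFunctor (h : G.SplitFromF) (hu : CatIsomorphism.LiftUnique G.CdashToC G.CdashToC)
    (hτ : G.tauDash.IsIsoInvariant) : SingleObj (CatAut G.Cv) ⥤ SingleObj (G.tauDash.autSplit hτ) :=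
  SingleObj.mapHom (CatAut G.Cv) (G.tauDash.autSplit hτ) (G.dashAscendHom h hu hτ)

/-- On endomorphisms of the unique object `dashKindFunctor` is `dashAscendHom`.
([IUTchI] Ex 3.3 (iii) (e) p.79) [claim: Mochizuki2012, status: disputed] -/
theorem dashKindFunctor_map (h : G.SplitFromF) (hu : CatIsomorphism.LiftUnique G.CdashToC G.CdashToC)
    (hτ : G.tauDash.IsIsoInvariant) (a : SingleObj.star (CatAut G.Cv) ⟶ SingleObj.star (CatAut G.Cv)) :
    (G.dashKindFunctor h hu hτ).map a = G.dashAscendHom h hu hτ a := rfl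

end Generic

/-! ### §3. Iso-invariance of the genuine `τ⊢_v = τ_p`, binder-free, and the kind functor at the place -/

section OfKit

variable {p : ℕ} [Fact p.Prime] {Dv Dd : Type u} [Category.{u} Dv] [Category.{u} Dd]
  (incl : Dd ⥤ Dv) (proj : Dv ⥤ Dd) (adj : proj ⊣ incl)
  (base : Dd ⥤ PadicFld.{u} p) (hloc : ∀ A : Dd, (base.obj A).IsPadicLocal)
  (hc : IsConnected Dd) (he : IsTotallyEpimorphic Dd) (hcV : IsConnected Dv) (heV : IsTotallyEpimorphic Dv)
  (Kv : Type) [Field Kv] [ValuativeRel Kv] (hp : ((p : Kv)) ∈ PadicFrd.intNonzero Kv) [incl.Full] [incl.Faithful]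

/-- **`τ⊢_v = τ_p` of abc-iut-L1-t4's assembled object `ofKit` is ISO-INVARIANT, binder-free**: for `i : A ⥲ B` in
`𝒞⊢_v` and `f ∈ τ_p(A)`, the conjugate `i⁻¹ f i` lies in `O^▷(B)` (`PreFrobenioid.endConj_mem`) and satisfies
`i⁻¹ ∘ f = (i⁻¹ f i) ∘ i⁻¹` with `i⁻¹` linear (`isLinear_of_isIso`), so it lies in `τ_p(B)` by the subfunctoriality
of `τ_p` ([FrdI] Def. 2.3 / [FrdII] Thm. 1.2 (v): `PadicFrd.Datum.mem_pSplittingSubmonoid_of_comp_eq`).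
([IUTchI] Ex 3.3 (iii) (e) p.79) [claim: Mochizuki2012, status: disputed] -/
theorem isIsoInvariant_tauDash_ofKit : (ofKit incl proj adj base hloc hc he hcV heV Kv hp).tauDash.IsIsoInvariant := by
  intro A B i f hf
  have hf' : f ∈ (Datum.prim base hloc hc he).pSplittingSubmonoid A := hf
  have hα : i.conj f ∈ PreFrobenioid.endSubmonoid (Datum.prim base hloc hc he).structureFunctor B :=
    PreFrobenioid.endConj_mem (Datum.prim base hloc hc he).structureFunctor i
      ((Datum.prim base hloc hc he).pSplittingSubmonoid_le A hf')
  exact (Datum.prim base hloc hc he).mem_pSplittingSubmonoid_of_comp_eq i.inv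
    (PreFrobenioid.isLinear_of_isIso (Datum.prim base hloc hc he).structureFunctor i.inv) hf' hα
    (by
      change i.inv ≫ (show A ⟶ A from f) = (i.inv ≫ (show A ⟶ A from f) ≫ i.hom) ≫ i.inv
      simp only [Category.assoc, Iso.hom_inv_id, Category.comp_id])

end OfKit

section OfGalois

variable {p : ℕ} [Fact p.Prime] (d : GaloisValDatum.{u} p) {P : Type u} [Group P] [TopologicalSpace P]
  (aug : P →* d.Gal) (hc : Continuous aug) (hs : Function.Surjective aug) (ho : IsOpenMap aug)
  (Kv : Type) [Field Kv] [ValuativeRel Kv] (hp : ((p : Kv)) ∈ PadicFrd.intNonzero Kv)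

/-- **`τ⊢_v` of `ofGalois` (REAL bases) is iso-invariant**, binder-free. ([IUTchI] Ex 3.3 (iii) (e) p.79) [claim: Mochizuki2012, status: disputed] -/
theorem isIsoInvariant_tauDash_ofGalois : (ofGalois d aug hc hs ho Kv hp).tauDash.IsIsoInvariant := by
  haveI := CosetCat.pull_full aug hc hs
  haveI := CosetCat.pull_faithful aug hc hs
  exact isIsoInvariant_tauDash_ofKit (CosetCat.pull aug hc hs) (CosetCat.push aug ho) (CosetCat.pushPullAdj aug hc hs ho)
    d.fieldFunctor d.fieldFunctor_isPadicLocal CosetCat.isConnected CosetCat.isTotallyEpimorphic CosetCat.isConnected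
    CosetCat.isTotallyEpimorphic Kv hp

end OfGalois

end GoodLocalFrobenioid

section Datum

variable {F : Type u} {K : Type} {Fbar : Type} [Field F] [NumberField F] [Field K] [NumberField K]
  [Algebra F K] [Field Fbar] [Algebra F Fbar] [Algebra K Fbar] [IsScalarTower F K Fbar] [Normal K Fbar]
  {E : WeierstrassCurve F} [E.IsElliptic] {l : ℕ} {Pb : BadPlacePredicates K}
  (D : InitialThetaData F K Fbar E l Pb) (p : ℕ) [Fact p.Prime]
  (k : Type) [NontriviallyNormedField k] [CompleteSpace k] [IsUltrametricDist k] [NormedAlgebra ℚ_[p] k]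
  [FiniteDimensional ℚ_[p] k] [Algebra K k]

namespace InitialThetaData

/-- **`τ⊢_v̲` AT THE PRINTED OBJECT `goodLocalFrobenioidOfEmb` is iso-invariant**, binder-free beyond `hX`.
([IUTchI] Ex 3.3 (iii) (e) p.79) [claim: Mochizuki2012, status: disputed] -/
theorem isIsoInvariant_tauDash_goodLocalFrobenioidOfEmb (ι : Fbar →ₐ[K] AlgebraicClosure k)
    (hX : IsOpen (D.PiXarrow : Set D.PiC)) :
    (@GoodLocalFrobenioid.tauDash p k _ (GaloisValDatum.normVal k) (D.goodLocalFrobenioidOfEmb p k ι hX)).IsIsoInvariant := by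
  letI := GaloisValDatum.normVal k
  exact GoodLocalFrobenioid.isIsoInvariant_tauDash_ofGalois (GaloisValDatum.ofComplete p k) _ _ _ _ k
    (GaloisValDatum.p_mem_normVal p k)

end InitialThetaData

end Datum

section Place

variable {F : Type u} {K : Type} {Fbar : Type} [Field F] [NumberField F] [Field K] [NumberField K]
  [Algebra F K] [Field Fbar] [Algebra F Fbar] [Algebra K Fbar] [IsScalarTower F K Fbar] [Normal K Fbar]
  {E : WeierstrassCurve F} [E.IsElliptic] {l : ℕ} {Pb : BadPlacePredicates K}
  (D : InitialThetaData F K Fbar E l Pb) (w : HeightOneSpectrum (𝓞 K)) (p : ℕ) [Fact p.Prime]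
  (hw : ((p : ℕ) : 𝓞 K) ∈ w.asIdeal)

namespace InitialThetaData

/-- **`τ⊢_v̲` AT THE FINITE PLACE `v̲ = w ∣ p` is iso-invariant** (`goodLocalFrobenioidAt`, `K_v̲ := K_w`), binder-free
beyond `hX`. ([IUTchI] Ex 3.3 (iii) (e) p.79) [claim: Mochizuki2012, status: disputed] -/
theorem isIsoInvariant_tauDash_goodLocalFrobenioidAt (hX : IsOpen (D.PiXarrow : Set D.PiC)) :
    (@GoodLocalFrobenioid.tauDash p (RescaledCompletion K p w hw) _
      (GaloisValDatum.normVal (RescaledCompletion K p w hw)) (D.goodLocalFrobenioidAt w p hw hX)).IsIsoInvariant := by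
  letI : Algebra K (RescaledCompletion K p w hw) := inferInstanceAs (Algebra K (w.adicCompletion K))
  haveI := GaloisValDatum.finiteDimensional_rescaledCompletion K p w hw
  exact D.isIsoInvariant_tauDash_goodLocalFrobenioidOfEmb p (RescaledCompletion K p w hw)
    (localEmb (K := K) (Fbar := Fbar) (AlgebraicClosure (RescaledCompletion K p w hw))) hX

/-- **[IUTchI] Ex. 3.3 (iii) (e) AS A KIND FUNCTOR AT THE PLACE `v̲ = w ∣ p`**: `ℱ̲_v̲ = 𝒞_v̲ ↦ ℱ⊢_v̲ = (𝒞⊢_v̲, τ⊢_v̲)`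
on one-object kinds — `SingleObj (CatAut 𝒞_v̲) ⥤ SingleObj Aut(ℱ⊢_v̲)`, t2's slot `dashOf v` at the genuine datum — with
displayed input EXACTLY clause (e) `he : SplitFromF` of the datum (dischargers of record: this seat's
`splitFromF_goodLocalFrobenioidAt_of_conj_autCongr` — binders `hX`, `hΔC`, `hΔ`, DATA `e`, `hconj` = GAP
G-L5t16g8-1 — or abc-iut-L5-t16's by-name form); the uniqueness and iso-invariance halves are THEOREMS
(`liftUnique_cdashToC_goodLocalFrobenioidAt`, `isIsoInvariant_tauDash_goodLocalFrobenioidAt`).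
([IUTchI] Ex 3.3 (iii) (e) p.79) [claim: Mochizuki2012, status: disputed] -/
def dashKindFunctorAt (hX : IsOpen (D.PiXarrow : Set D.PiC))
    (he : @GoodLocalFrobenioid.SplitFromF p (RescaledCompletion K p w hw) _
      (GaloisValDatum.normVal (RescaledCompletion K p w hw)) (D.goodLocalFrobenioidAt w p hw hX)) :
    SingleObj (CatAut (@GoodLocalFrobenioid.Cv p (RescaledCompletion K p w hw) _
        (GaloisValDatum.normVal (RescaledCompletion K p w hw)) (D.goodLocalFrobenioidAt w p hw hX))) ⥤
      SingleObj ((@GoodLocalFrobenioid.tauDash p (RescaledCompletion K p w hw) _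
        (GaloisValDatum.normVal (RescaledCompletion K p w hw)) (D.goodLocalFrobenioidAt w p hw hX)).autSplit
        (D.isIsoInvariant_tauDash_goodLocalFrobenioidAt w p hw hX)) :=
  @GoodLocalFrobenioid.dashKindFunctor p (RescaledCompletion K p w hw) _
    (GaloisValDatum.normVal (RescaledCompletion K p w hw)) (D.goodLocalFrobenioidAt w p hw hX) he
    (D.liftUnique_cdashToC_goodLocalFrobenioidAt w p hw hX) (D.isIsoInvariant_tauDash_goodLocalFrobenioidAt w p hw hX)

end InitialThetaData

end Place

end Literature.IUT.HodgeTheaters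

end
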